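import Summits.CriticalPhenomena.Ising3D.Control2DReadoutWindow
import Summits.CriticalPhenomena.Ising3D.Control2DL15BoxUData60
import Summits.CriticalPhenomena.Ising3D.Control2DL15BoxURegion
import Mathlib.Tactic.NormNum
import Mathlib.Tactic.Linarith
import HarnessLib

/-!
# Readout certificate B15 over a WINDOW: `f(4.15) < f(Δ)` for EVERY `Δ ∈ [2.0625, 4.12]` — the near-zero at `4.15 ± 0.03` is the
least value of the scalar-channel action over the whole window `[2.0625, 4.15 + 0.03]` (cell `pub-ising3x`, seat controls-1 gen 29;
KERNEL, certificate kind "readout", continuum form — CONTROL-ONLY)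

HONEST FRAMING: lottery ticket; floor = tightest certified 3D Ising CFT bounds; no exact-solution
claim without a proof. CONTROL-ONLY (`d = 2`, `Δ_σ = 1/8`); a statement about one of our INSTRUMENTS (the kernel-certified Λ = 15
lower-edge box functional `wtboxU`: RB-4 `j127796` (Λ = 15, E₀ = 40); box `[97/100, 39/40]`), not about a CFT; nothing about `d = 3`.

`Control2DReadoutB15.dip0_B15` samples `f(Δ) = φ[F^{1/8}_-[g_{Δ,0}]]` at `{4, 4.12, 4.15, 4.15+0.03}`. Here `f(4.15) < f(Δ)` is
certified for the CONTINUUM `Δ ∈ [33/16, 103 / 25]` by three Bernstein cells of the window polynomial (`Control2DReadoutWindow.windowCheck`: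
cell polynomial `phatboxUs0 = cellPolyZ wtboxU slL15 15 0 71` of the landed replay, digit cut `10^482` as in its landed cells, readout truncation
`N = 160`, region threshold `E₀ = 40`). Below `Δ = 2.0625` the action falls to its BINDING zero at the gap edge `Δ = 2` (a boundary zero
of the certificate: `f(2)/f(4.15) ≈ 0.02`), so the window starts just above it. With `dip0_B15` (`f(4.15) < f(4.15 + 0.03)`): over
`[2.0625, 4.15 + 0.03]` the least value is attained only inside `(4.12, 4.15 + 0.03)` — the instrument's first excited near-zero sits at
`δ₀(15) = 0.15 ± 0.03` above `T T̄ = 4` with NO lower excursion anywhere in `[2.0625, 4.12]`. Zero grant compute. No facts, standard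
axioms only. [cite: RattazziEtAl2008, §5.5]
-/

namespace Summit.CriticalPhenomena.Ising3D.Control2D

open Set
open Literature.MathematicalPhysics.QuantumFieldTheory.ConformalBootstrap3D

set_option maxHeartbeats 0 in
set_option maxRecDepth 200000 in
/-- Window cell 1: `y ∈ [33/32, 51/32]` (`Δ ∈ [2.0625, 3.1875]`). [folklore] -/
theorem windowCheck_B15_c1 : windowCheck wtboxU slL15 15 71 482 160 40 (83 / 20) 32 33 18 phatboxUs0 = true := by
  decide +kernel

set_option maxHeartbeats 0 in
set_option maxRecDepth 200000 in
/-- Window cell 2: `y ∈ [102/64, 121/64]` (`Δ ∈ [3.1875, 3.78125]`). [folklore] -/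
theorem windowCheck_B15_c2 : windowCheck wtboxU slL15 15 71 482 160 40 (83 / 20) 64 102 19 phatboxUs0 = true := by
  decide +kernel

set_option maxHeartbeats 0 in
set_option maxRecDepth 200000 in
/-- Window cell 3: `y ∈ [3025/1600, 3296/1600]` (`Δ ∈ [3.78125, 4.12]`). [folklore] -/
theorem windowCheck_B15_c3 : windowCheck wtboxU slL15 15 71 482 160 40 (83 / 20) 1600 3025 271 phatboxUs0 = true := by
  decide +kernel

set_option maxRecDepth 8192 in
/-- **B15 window readout, kernel-complete**: for `φ = taylorFunctional2D (1/2) slL15 wtboxU` (`Δ_σ = 1/8`, scalar channel) and EVERY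
`Δ ∈ [33/16, 103 / 25]`: `f(83 / 20) < f(Δ)`. CONTROL-ONLY (d = 2). [cite: RattazziEtAl2008, §5.5] -/
theorem window_B15 (Δ : ℝ) (h1 : (33 : ℝ) / 16 ≤ Δ) (h2 : Δ ≤ 103 / 25) :
    taylorFunctional2D (1 / 2) slL15.toFinset (fun p => (wtboxU p : ℝ)) (crossF (1 / 8) (-1) (globalBlock (83 / 20) 0)) <
      taylorFunctional2D (1 / 2) slL15.toFinset (fun p => (wtboxU p : ℝ)) (crossF (1 / 8) (-1) (globalBlock Δ 0)) := by
  have hR := (region_of_kernelCertAuto wtboxU slL15_nodup slL15_deg 15 16 (by norm_num) (by norm_num) PregboxU_eq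
      (by decide +kernel) QhatboxU_eq _ cregboxU_n0 cregJboxU (by decide) cregJboxU_ok)
  have em : (((83 / 20 : ℚ)) : ℝ) = 83 / 20 := by norm_num
  rcases le_total Δ (51 / 16) with hA | hA
  · have h := window_lt_of_windowCheck wtboxU slL15_nodup slL15_deg phatboxUs0_eq
      (fun b J hb hE => hR b J hb (by exact_mod_cast hE)) windowCheck_B15_c1 (Δ := Δ)
      (by push_cast; linarith) (by push_cast; linarith)
    rwa [em] at h
  rcases le_total Δ (121 / 32) with hB | hB
  · have h := window_lt_of_windowCheck wtboxU slL15_nodup slL15_deg phatboxUs0_eq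
      (fun b J hb hE => hR b J hb (by exact_mod_cast hE)) windowCheck_B15_c2 (Δ := Δ)
      (by push_cast; linarith) (by push_cast; linarith)
    rwa [em] at h
  · have h := window_lt_of_windowCheck wtboxU slL15_nodup slL15_deg phatboxUs0_eq
      (fun b J hb hE => hR b J hb (by exact_mod_cast hE)) windowCheck_B15_c3 (Δ := Δ)
      (by push_cast; linarith) (by push_cast; linarith)
    rwa [em] at h

end Summit.CriticalPhenomena.Ising3D.Control2D
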